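import Literature.Analysis.FluidPDE.DriftHeatKernel
import Literature.Analysis.FluidPDE.WeightedParametricIntegral
import Literature.Analysis.FluidPDE.WholeSpaceIBP
import HarnessLib

/-!
# Kernel barriers `Ψ(σ, x) = ∫ h(z) k_ε(σ, x − z) dz` for the drift–heat equation

Analysis/FluidPDE support file for the proof of the named fact
`Literature.Analysis.FluidPDE.KNSS2009_lemma21` (KNSS 2009, Lemma 2.1 as printed). For a
continuous compactly supported weight `h ≥ 0` (in the application: a cut-off times a time
slice of a nonnegative solution) and the drift-robust heat kernels `k_ε = driftKernel ε A`
of `DriftHeatKernel`, the **kernel barrier** is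

  `driftKernelBarrier ε A h σ x = ∫ h z * driftKernel ε A σ (x − z) dz`.

We prove that it inherits everything the comparison principle
(`DriftHeatLocalComparison`) asks of a classical barrier:

* `C²` slices with `∇Ψ = ∫ h ∇k(· − z)`, `ΔΨ = ∫ h Δk(· − z)` (differentiation under the
  integral, `WeightedParametricIntegral`, and `Δ = Σᵢ ∂ᵢ∂ᵢ` on an orthonormal basis);
* a `σ`-derivative `∂_σ Ψ = ∫ h ∂_σ k(· − z)` (`driftKernelBarrierDt`), and joint/slice
  continuity of `Ψ`, `∂_σΨ`, `∇Ψ`, `ΔΨ` on `{σ > 0}`;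
* the **barrier inequality** `A ‖∇Ψ‖ ≤ ε (∂_σ Ψ − ΔΨ)` for `h ≥ 0`, `ε = ±1`
  (`driftKernelBarrier_ineq`, integrating `driftKernel_ineq` against `h ≥ 0`): `Ψ₊` is a
  supersolution and `Ψ₋` a subsolution of `Ψ_σ = ΔΨ − a·∇Ψ` for every drift `‖a‖ ≤ A`;
* order properties: `Ψ ≥ 0`, and `Ψ σ x ≤ ∫ g` / `∫ g ≤ Ψ σ x` from pointwise bounds of the
  integrand (used with explicit Gaussian bounds of the kernel on and off a ball).

## References

* G. Koch, N. Nadirashvili, G. Seregin, V. Šverák, *Liouville theorems for the Navier–Stokes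
  equations and applications*, Acta Math. 203 (2009) = arXiv:0709.3599, Lemma 2.1 (p. 5).
  [KochNadirashviliSereginSverak2009]
* G. M. Lieberman, *Second Order Parabolic Differential Equations*, World Scientific (1996),
  Ch. II (comparison with explicit sub/supersolutions). [Lieberman1996]
-/

noncomputable section

open MeasureTheory Real Set Filter Topology InnerProductSpace Function Metric
open scoped RealInnerProductSpace Laplacian ContDiff

namespace Literature.Analysis.FluidPDE

variable {E : Type*} [NormedAddCommGroup E] [InnerProductSpace ℝ E] [FiniteDimensional ℝ E]
  [MeasurableSpace E] [BorelSpace E]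

/-! ### The barrier and its `σ`-derivative -/

/-- **The kernel barrier** `Ψ_ε(σ, x) = ∫ h(z) k_ε(σ, x − z) dz` built from a weight `h` and
the drift-robust heat kernel `driftKernel ε A`. [folklore] -/
def driftKernelBarrier (ε A : ℝ) (h : E → ℝ) (σ : ℝ) (x : E) : ℝ :=
  ∫ z, h z * driftKernel ε A σ (x - z)

/-- The `σ`-derivative `∫ h(z) ∂_σ k_ε(σ, x − z) dz` of the kernel barrier (see
`hasDerivAt_driftKernelBarrier_sigma`). [folklore] -/
def driftKernelBarrierDt (ε A : ℝ) (h : E → ℝ) (σ : ℝ) (x : E) : ℝ :=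
  ∫ z, h z * driftKernelDt ε A σ (x - z)

section Regularity

variable {ε A : ℝ} {h : E → ℝ}

/-- `smul` form of the barrier. [folklore] -/
theorem driftKernelBarrier_eq_integral_smul (ε A : ℝ) (h : E → ℝ) (σ : ℝ) (x : E) :
    driftKernelBarrier ε A h σ x = ∫ z, h z • driftKernel ε A σ (x - z) := by
  simp [driftKernelBarrier, smul_eq_mul]

/-- `smul` form of the `σ`-derivative. [folklore] -/
theorem driftKernelBarrierDt_eq_integral_smul (ε A : ℝ) (h : E → ℝ) (σ : ℝ) (x : E) :
    driftKernelBarrierDt ε A h σ x = ∫ z, h z • driftKernelDt ε A σ (x - z) := by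
  simp [driftKernelBarrierDt, smul_eq_mul]

/-! #### Joint continuity of the shifted kernel data -/

omit [MeasurableSpace E] [BorelSpace E] [FiniteDimensional ℝ E] [InnerProductSpace ℝ E] in
/-- `(q, z) ↦ F(q.1, q.2 − z)` is continuous on `(Ioi 0 ×ˢ univ) ×ˢ univ` when `F` is
continuous on `Ioi 0 ×ˢ univ`. [folklore] -/
theorem continuousOn_shift {Y : Type*} [TopologicalSpace Y] {F : ℝ × E → Y}
    (hF : ContinuousOn F (Ioi 0 ×ˢ univ)) :
    ContinuousOn (fun q : (ℝ × E) × E => F (q.1.1, q.1.2 - q.2))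
      ((Ioi (0 : ℝ) ×ˢ (univ : Set E)) ×ˢ (univ : Set E)) := by
  refine hF.comp (by fun_prop) ?_
  rintro ⟨⟨σ, x⟩, z⟩ ⟨⟨hσ, -⟩, -⟩
  exact ⟨hσ, mem_univ _⟩

omit [MeasurableSpace E] [BorelSpace E] [FiniteDimensional ℝ E] [InnerProductSpace ℝ E] in
/-- For fixed `σ > 0`: `(x, z) ↦ F(σ, x − z)` is continuous when `F` is continuous on
`Ioi 0 ×ˢ univ`. [folklore] -/
theorem continuousOn_shift_space {Y : Type*} [TopologicalSpace Y] {F : ℝ × E → Y}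
    (hF : ContinuousOn F (Ioi 0 ×ˢ univ)) {σ : ℝ} (hσ : 0 < σ) :
    ContinuousOn (fun q : E × E => F (σ, q.1 - q.2)) ((univ : Set E) ×ˢ (univ : Set E)) := by
  refine hF.comp (by fun_prop) ?_
  rintro ⟨x, z⟩ -
  exact ⟨hσ, mem_univ _⟩

omit [MeasurableSpace E] [BorelSpace E] [FiniteDimensional ℝ E] [InnerProductSpace ℝ E] in
/-- For fixed `x`: `(σ, z) ↦ F(σ, x − z)` is continuous on `Ioi 0 ×ˢ univ` when `F` is.
[folklore] -/
theorem continuousOn_shift_time {Y : Type*} [TopologicalSpace Y] {F : ℝ × E → Y}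
    (hF : ContinuousOn F (Ioi 0 ×ˢ univ)) (x : E) :
    ContinuousOn (fun q : ℝ × E => F (q.1, x - q.2)) (Ioi (0 : ℝ) ×ˢ (univ : Set E)) := by
  refine hF.comp (by fun_prop) ?_
  rintro ⟨σ, z⟩ ⟨hσ, -⟩
  exact ⟨hσ, mem_univ _⟩

omit [MeasurableSpace E] [BorelSpace E] [FiniteDimensional ℝ E] [InnerProductSpace ℝ E] in
/-- For fixed `σ > 0` and `x`: `z ↦ F(σ, x − z)` is continuous when `F` is continuous on
`Ioi 0 ×ˢ univ`. [folklore] -/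
theorem continuous_shift_slice {Y : Type*} [TopologicalSpace Y] {F : ℝ × E → Y}
    (hF : ContinuousOn F (Ioi 0 ×ˢ univ)) {σ : ℝ} (hσ : 0 < σ) (x : E) :
    Continuous fun z : E => F (σ, x - z) := by
  have hg : Continuous fun z : E => ((σ, x - z) : ℝ × E) := by fun_prop
  exact hF.comp_continuous hg fun z => ⟨hσ, mem_univ _⟩

omit [BorelSpace E] [FiniteDimensional ℝ E] [InnerProductSpace ℝ E] [MeasurableSpace E] in
/-- A product `z ↦ f z * g z` with `f` compactly supported is compactly supported (stated for
the lambda, to keep unification first order). [folklore] -/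
theorem hasCompactSupport_mul_lambda {f g : E → ℝ} (hf : HasCompactSupport f) :
    HasCompactSupport fun z => f z * g z :=
  HasCompactSupport.intro hf fun z hz => by simp [image_eq_zero_of_notMem_tsupport hz]

/-! #### Space derivatives of the barrier -/

variable (hh : Continuous h) (hhs : HasCompactSupport h)
include hh hhs

/-- First space derivative under the integral: `DΨ(σ, ·)(x) = ∫ h(z) Dk(σ, ·)(x − z) dz`
(`σ > 0`). [folklore] -/
theorem hasFDerivAt_driftKernelBarrier {σ : ℝ} (hσ : 0 < σ) (x : E) :
    HasFDerivAt (driftKernelBarrier ε A h σ)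
      (∫ z, h z • fderiv ℝ (driftKernel (E := E) ε A σ) (x - z)) x := by
  have hk : ContDiff ℝ 2 (driftKernel (E := E) ε A σ) := contDiff_driftKernel ε A hσ
  have hfun : driftKernelBarrier ε A h σ = fun x => ∫ z, h z • driftKernel ε A σ (x - z) :=
    funext fun x => driftKernelBarrier_eq_integral_smul ε A h σ x
  rw [hfun]
  refine hasFDerivAt_integral_smul_of_continuousOn (μ := volume) hh hhs
    (F := fun x z => driftKernel ε A σ (x - z))
    (F' := fun x z => fderiv ℝ (driftKernel (E := E) ε A σ) (x - z)) isOpen_univ ?_ ?_ ?_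
    (mem_univ x)
  · exact (hk.continuous.comp (by fun_prop)).continuousOn
  · exact ((hk.continuous_fderiv (by norm_num)).comp (by fun_prop)).continuousOn
  · intro x _ z
    have h1 : HasFDerivAt (fun x : E => x - z) (ContinuousLinearMap.id ℝ E) x :=
      (hasFDerivAt_id x).sub_const z
    have h2 := ((hk.differentiable (by norm_num)) (x - z)).hasFDerivAt.comp x h1
    rwa [ContinuousLinearMap.comp_id] at h2

/-- The gradient of the barrier as a function. [folklore] -/
theorem fderiv_driftKernelBarrier {σ : ℝ} (hσ : 0 < σ) :
    fderiv ℝ (driftKernelBarrier ε A h σ) =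
      fun x => ∫ z, h z • fderiv ℝ (driftKernel (E := E) ε A σ) (x - z) :=
  funext fun x => (hasFDerivAt_driftKernelBarrier hh hhs hσ x).fderiv

/-- Second space derivative under the integral. [folklore] -/
theorem hasFDerivAt_fderiv_driftKernelBarrier {σ : ℝ} (hσ : 0 < σ) (x : E) :
    HasFDerivAt (fderiv ℝ (driftKernelBarrier ε A h σ))
      (∫ z, h z • fderiv ℝ (fderiv ℝ (driftKernel (E := E) ε A σ)) (x - z)) x := by
  have hk : ContDiff ℝ 2 (driftKernel (E := E) ε A σ) := contDiff_driftKernel ε A hσ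
  have hk1 : ContDiff ℝ 1 (fderiv ℝ (driftKernel (E := E) ε A σ)) :=
    hk.fderiv_right (by norm_num)
  rw [fderiv_driftKernelBarrier hh hhs hσ]
  refine hasFDerivAt_integral_smul_of_continuousOn (μ := volume) hh hhs
    (F := fun x z => fderiv ℝ (driftKernel (E := E) ε A σ) (x - z))
    (F' := fun x z => fderiv ℝ (fderiv ℝ (driftKernel (E := E) ε A σ)) (x - z)) isOpen_univ
    ?_ ?_ ?_ (mem_univ x)
  · exact (hk1.continuous.comp (by fun_prop)).continuousOn
  · exact ((hk1.continuous_fderiv (by norm_num)).comp (by fun_prop)).continuousOn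
  · intro x _ z
    have h1 : HasFDerivAt (fun x : E => x - z) (ContinuousLinearMap.id ℝ E) x :=
      (hasFDerivAt_id x).sub_const z
    have h2 := ((hk1.differentiable (by norm_num)) (x - z)).hasFDerivAt.comp x h1
    rwa [ContinuousLinearMap.comp_id] at h2

/-- The slices `Ψ(σ, ·)`, `σ > 0`, are `C²`. [folklore] -/
theorem contDiff_driftKernelBarrier {σ : ℝ} (hσ : 0 < σ) :
    ContDiff ℝ 2 (driftKernelBarrier ε A h σ) := by
  have hk : ContDiff ℝ 2 (driftKernel (E := E) ε A σ) := contDiff_driftKernel ε A hσ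
  have hk1 : ContDiff ℝ 1 (fderiv ℝ (driftKernel (E := E) ε A σ)) :=
    hk.fderiv_right (by norm_num)
  refine (contDiff_succ_iff_hasFDerivAt (n := 1)).2
    ⟨_, ?_, hasFDerivAt_driftKernelBarrier hh hhs hσ⟩
  refine (contDiff_succ_iff_hasFDerivAt (n := 0)).2
    ⟨fun x => ∫ z, h z • fderiv ℝ (fderiv ℝ (driftKernel (E := E) ε A σ)) (x - z), ?_,
      fun x => ?_⟩
  · have hc : Continuous fun x : E =>
        ∫ z, h z • fderiv ℝ (fderiv ℝ (driftKernel (E := E) ε A σ)) (x - z) := by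
      rw [← continuousOn_univ]
      refine continuousOn_integral_smul_of_continuousOn (μ := volume) hh hhs
        (F := fun x z => fderiv ℝ (fderiv ℝ (driftKernel (E := E) ε A σ)) (x - z)) ?_
      exact ((hk1.continuous_fderiv (by norm_num)).comp (by fun_prop)).continuousOn
    exact_mod_cast contDiff_zero.2 hc
  · have h := hasFDerivAt_fderiv_driftKernelBarrier (ε := ε) (A := A) hh hhs hσ x
    rwa [fderiv_driftKernelBarrier hh hhs hσ] at h

/-- Integrability of `z ↦ h z • Dk(σ, ·)(x − z)` (continuous, compact support). [folklore] -/
theorem integrable_smul_fderiv_driftKernel {σ : ℝ} (hσ : 0 < σ) (x : E) :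
    Integrable fun z => h z • fderiv ℝ (driftKernel (E := E) ε A σ) (x - z) := by
  have hk : ContDiff ℝ 2 (driftKernel (E := E) ε A σ) := contDiff_driftKernel ε A hσ
  refine Continuous.integrable_of_hasCompactSupport ?_
    (hhs.smul_right (f' := fun z => fderiv ℝ (driftKernel (E := E) ε A σ) (x - z)))
  exact hh.smul ((hk.continuous_fderiv (by norm_num)).comp (by fun_prop))

/-- Integrability of `z ↦ h z * Δk(σ, ·)(x − z)` (continuous, compact support). [folklore] -/
theorem integrable_mul_laplacian_driftKernel {σ : ℝ} (hσ : 0 < σ) (x : E) :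
    Integrable fun z => h z * (Δ (driftKernel (E := E) ε A σ)) (x - z) := by
  have h1 : Continuous fun z : E => (Δ (driftKernel (E := E) ε A σ)) (x - z) :=
    continuous_shift_slice (F := fun p : ℝ × E => (Δ (driftKernel (E := E) ε A p.1)) p.2)
      (continuousOn_laplacian_driftKernel (E := E) ε A) hσ x
  have h2 : HasCompactSupport fun z => h z * (Δ (driftKernel (E := E) ε A σ)) (x - z) :=
    hasCompactSupport_mul_lambda hhs
  exact (hh.mul h1).integrable_of_hasCompactSupport h2

/-- Directional first derivatives of the barrier as scalar integrals:
`∂_v Ψ(σ, ·)(y) = ∫ h(z) ∂_v k(σ, ·)(y − z) dz`. [folklore] -/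
theorem fderiv_driftKernelBarrier_apply {σ : ℝ} (hσ : 0 < σ) (y v : E) :
    fderiv ℝ (driftKernelBarrier ε A h σ) y v =
      ∫ z, h z * fderiv ℝ (driftKernel (E := E) ε A σ) (y - z) v := by
  rw [(hasFDerivAt_driftKernelBarrier hh hhs hσ y).fderiv,
    ContinuousLinearMap.integral_apply (integrable_smul_fderiv_driftKernel hh hhs hσ y) v]
  refine integral_congr_ae (Eventually.of_forall fun z => ?_)
  simp [smul_eq_mul]

/-- Second directional derivatives of the barrier under the integral:
`y ↦ ∂_v Ψ(σ, ·)(y)` has derivative `∫ h(z) D(∂_v k(σ, ·))(x − z) dz` at `x`. [folklore] -/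
theorem hasFDerivAt_fderiv_driftKernelBarrier_apply {σ : ℝ} (hσ : 0 < σ) (x v : E) :
    HasFDerivAt (fun y => fderiv ℝ (driftKernelBarrier ε A h σ) y v)
      (∫ z, h z • fderiv ℝ (fun w => fderiv ℝ (driftKernel (E := E) ε A σ) w v) (x - z)) x := by
  have hk : ContDiff ℝ 2 (driftKernel (E := E) ε A σ) := contDiff_driftKernel ε A hσ
  have hkv : ContDiff ℝ 1 (fun w => fderiv ℝ (driftKernel (E := E) ε A σ) w v) :=
    (hk.fderiv_right (m := 1) le_rfl).clm_apply contDiff_const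
  have hfun : (fun y => fderiv ℝ (driftKernelBarrier ε A h σ) y v) =
      fun y => ∫ z, h z • fderiv ℝ (driftKernel (E := E) ε A σ) (y - z) v := by
    funext y
    rw [fderiv_driftKernelBarrier_apply hh hhs hσ y v]
    simp [smul_eq_mul]
  rw [hfun]
  refine hasFDerivAt_integral_smul_of_continuousOn (μ := volume) hh hhs
    (F := fun y z => fderiv ℝ (driftKernel (E := E) ε A σ) (y - z) v)
    (F' := fun y z => fderiv ℝ (fun w => fderiv ℝ (driftKernel (E := E) ε A σ) w v) (y - z))
    isOpen_univ ?_ ?_ ?_ (mem_univ x)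
  · exact (hkv.continuous.comp (by fun_prop)).continuousOn
  · exact ((hkv.continuous_fderiv (by norm_num)).comp (by fun_prop)).continuousOn
  · intro y _ z
    have h1 : HasFDerivAt (fun y : E => y - z) (ContinuousLinearMap.id ℝ E) y :=
      (hasFDerivAt_id y).sub_const z
    have h2 := ((hkv.differentiable (by norm_num)) (y - z)).hasFDerivAt.comp y h1
    rwa [ContinuousLinearMap.comp_id] at h2

/-- **Laplacian under the integral**: `ΔΨ(σ, ·)(x) = ∫ h(z) Δk(σ, ·)(x − z) dz` (`σ > 0`);
via `Δ = Σᵢ ∂ᵢ∂ᵢ` over an orthonormal basis for `Ψ` and for `k`. [folklore] -/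
theorem laplacian_driftKernelBarrier {σ : ℝ} (hσ : 0 < σ) (x : E) :
    (Δ (driftKernelBarrier ε A h σ)) x =
      ∫ z, h z * (Δ (driftKernel (E := E) ε A σ)) (x - z) := by
  classical
  set b := stdOrthonormalBasis ℝ E with hb
  have hk : ContDiff ℝ 2 (driftKernel (E := E) ε A σ) := contDiff_driftKernel ε A hσ
  have hΨ : ContDiff ℝ 2 (driftKernelBarrier ε A h σ) := contDiff_driftKernelBarrier hh hhs hσ
  have hkv : ∀ v : E, ContDiff ℝ 1 (fun w => fderiv ℝ (driftKernel (E := E) ε A σ) w v) :=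
    fun v => (hk.fderiv_right (m := 1) le_rfl).clm_apply contDiff_const
  -- integrability of the scalar second-derivative integrands
  have hci : ∀ v : E, Continuous fun z => h z •
      fderiv ℝ (fun w => fderiv ℝ (driftKernel (E := E) ε A σ) w v) (x - z) := fun v =>
    hh.smul (((hkv v).continuous_fderiv (by norm_num)).comp (by fun_prop))
  have hii : ∀ v : E, Integrable fun z => h z •
      fderiv ℝ (fun w => fderiv ℝ (driftKernel (E := E) ε A σ) w v) (x - z) := fun v =>
    (hci v).integrable_of_hasCompactSupport (hhs.smul_right
      (f' := fun z => fderiv ℝ (fun w => fderiv ℝ (driftKernel (E := E) ε A σ) w v) (x - z)))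
  have hterm : ∀ i, fderiv ℝ (fun y => fderiv ℝ (driftKernelBarrier ε A h σ) y (b i)) x (b i) =
      ∫ z, h z * fderiv ℝ (fun w => fderiv ℝ (driftKernel (E := E) ε A σ) w (b i)) (x - z)
        (b i) := by
    intro i
    rw [(hasFDerivAt_fderiv_driftKernelBarrier_apply hh hhs hσ x (b i)).fderiv,
      ContinuousLinearMap.integral_apply (hii (b i)) (b i)]
    refine integral_congr_ae (Eventually.of_forall fun z => ?_)
    simp [smul_eq_mul]
  have hiterm : ∀ i, Integrable fun z => h z *
      fderiv ℝ (fun w => fderiv ℝ (driftKernel (E := E) ε A σ) w (b i)) (x - z) (b i) :=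
    fun i => ((hii (b i)).apply_continuousLinearMap (b i)).congr
      (Eventually.of_forall fun z => by simp [smul_eq_mul])
  rw [laplacian_eq_sum_fderiv_fderiv b hΨ x]
  simp_rw [hterm]
  rw [← integral_finsetSum _ fun i _ => hiterm i]
  refine integral_congr_ae (Eventually.of_forall fun z => ?_)
  beta_reduce
  rw [laplacian_eq_sum_fderiv_fderiv b hk (x - z), Finset.mul_sum]

/-! #### The `σ`-derivative and continuity in `σ` -/

/-- `σ`-derivative under the integral: `∂_σ Ψ(σ, x) = ∫ h(z) ∂_σ k(σ, x − z) dz` (`σ > 0`).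
[folklore] -/
theorem hasDerivAt_driftKernelBarrier_sigma {σ : ℝ} (hσ : 0 < σ) (x : E) :
    HasDerivAt (fun σ' => driftKernelBarrier ε A h σ' x) (driftKernelBarrierDt ε A h σ x) σ := by
  have hfun : (fun σ' => driftKernelBarrier ε A h σ' x) =
      fun σ' => ∫ z, h z • driftKernel ε A σ' (x - z) :=
    funext fun σ' => driftKernelBarrier_eq_integral_smul ε A h σ' x
  rw [hfun, driftKernelBarrierDt_eq_integral_smul]
  refine hasDerivAt_integral_smul_of_continuousOn (μ := volume) hh hhs
    (F := fun σ' z => driftKernel ε A σ' (x - z))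
    (F' := fun σ' z => driftKernelDt ε A σ' (x - z)) isOpen_Ioi ?_ ?_ ?_ hσ
  · exact continuousOn_shift_time (continuousOn_driftKernel ε A) x
  · exact continuousOn_shift_time (continuousOn_driftKernelDt ε A) x
  · intro σ' hσ' z
    exact hasDerivAt_driftKernel_sigma ε A hσ' (x - z)

/-- Joint continuity of `(σ, x) ↦ Ψ(σ, x)` on `{σ > 0} × E`. [folklore] -/
theorem continuousOn_driftKernelBarrier :
    ContinuousOn (fun p : ℝ × E => driftKernelBarrier ε A h p.1 p.2) (Ioi 0 ×ˢ univ) := by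
  have hfun : (fun p : ℝ × E => driftKernelBarrier ε A h p.1 p.2) =
      fun p : ℝ × E => ∫ z, h z • driftKernel ε A p.1 (p.2 - z) :=
    funext fun p : ℝ × E => driftKernelBarrier_eq_integral_smul ε A h p.1 p.2
  rw [hfun]
  exact continuousOn_integral_smul_of_continuousOn (μ := volume) hh hhs
    (F := fun (p : ℝ × E) z => driftKernel ε A p.1 (p.2 - z))
    (continuousOn_shift (continuousOn_driftKernel ε A))

/-- Continuity of `σ ↦ ∂_σ Ψ(σ, x)` on `{σ > 0}`. [folklore] -/
theorem continuousOn_driftKernelBarrierDt (x : E) :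
    ContinuousOn (fun σ => driftKernelBarrierDt ε A h σ x) (Ioi 0) := by
  have hfun : (fun σ => driftKernelBarrierDt ε A h σ x) =
      fun σ => ∫ z, h z • driftKernelDt ε A σ (x - z) :=
    funext fun σ => driftKernelBarrierDt_eq_integral_smul ε A h σ x
  rw [hfun]
  exact continuousOn_integral_smul_of_continuousOn (μ := volume) hh hhs
    (F := fun σ z => driftKernelDt ε A σ (x - z))
    (continuousOn_shift_time (continuousOn_driftKernelDt ε A) x)

/-- Continuity of `σ ↦ ∇Ψ(σ, ·)(x)` on `{σ > 0}`. [folklore] -/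
theorem continuousOn_fderiv_driftKernelBarrier (x : E) :
    ContinuousOn (fun σ => fderiv ℝ (driftKernelBarrier ε A h σ) x) (Ioi 0) := by
  have hfun : ∀ σ ∈ Ioi (0 : ℝ), fderiv ℝ (driftKernelBarrier ε A h σ) x =
      ∫ z, h z • fderiv ℝ (driftKernel (E := E) ε A σ) (x - z) :=
    fun σ hσ => (hasFDerivAt_driftKernelBarrier hh hhs hσ x).fderiv
  refine ContinuousOn.congr ?_ hfun
  exact continuousOn_integral_smul_of_continuousOn (μ := volume) hh hhs
    (F := fun σ z => fderiv ℝ (driftKernel (E := E) ε A σ) (x - z))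
    (continuousOn_shift_time (continuousOn_fderiv_driftKernel ε A) x)

/-- Continuity of `σ ↦ ΔΨ(σ, ·)(x)` on `{σ > 0}`. [folklore] -/
theorem continuousOn_laplacian_driftKernelBarrier (x : E) :
    ContinuousOn (fun σ => (Δ (driftKernelBarrier ε A h σ)) x) (Ioi 0) := by
  have hfun : ∀ σ ∈ Ioi (0 : ℝ), (Δ (driftKernelBarrier ε A h σ)) x =
      ∫ z, h z • (Δ (driftKernel (E := E) ε A σ)) (x - z) := fun σ hσ => by
    rw [laplacian_driftKernelBarrier hh hhs hσ x]
    simp [smul_eq_mul]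
  refine ContinuousOn.congr ?_ hfun
  exact continuousOn_integral_smul_of_continuousOn (μ := volume) hh hhs
    (F := fun σ z => (Δ (driftKernel (E := E) ε A σ)) (x - z))
    (continuousOn_shift_time (continuousOn_laplacian_driftKernel ε A) x)

/-! #### The barrier inequality -/

/-- **The kernel barriers are sub/supersolutions for every drift `‖a‖ ≤ A`**: for `h ≥ 0`
continuous with compact support, `ε = ±1`, `A ≥ 0`, `σ > 0` and every `x`,
`A ‖∇Ψ(σ, ·)(x)‖ ≤ ε (∂_σ Ψ(σ, x) − ΔΨ(σ, ·)(x))` (integrate `driftKernel_ineq` against `h`).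
[folklore] -/
theorem driftKernelBarrier_ineq (h0 : ∀ z, 0 ≤ h z) (hε : ε = 1 ∨ ε = -1) (hA : 0 ≤ A)
    {σ : ℝ} (hσ : 0 < σ) (x : E) :
    A * ‖fderiv ℝ (driftKernelBarrier ε A h σ) x‖ ≤
      ε * (driftKernelBarrierDt ε A h σ x - (Δ (driftKernelBarrier ε A h σ)) x) := by
  have hk : ContDiff ℝ 2 (driftKernel (E := E) ε A σ) := contDiff_driftKernel ε A hσ
  rw [(hasFDerivAt_driftKernelBarrier hh hhs hσ x).fderiv, laplacian_driftKernelBarrier hh hhs hσ,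
    driftKernelBarrierDt]
  -- integrability of the three integrands
  have hiD : Integrable fun z => h z • fderiv ℝ (driftKernel (E := E) ε A σ) (x - z) :=
    integrable_smul_fderiv_driftKernel hh hhs hσ x
  have hcT : Continuous fun z => h z * driftKernelDt ε A σ (x - z) :=
    hh.mul (continuous_shift_slice (F := fun p : ℝ × E => driftKernelDt ε A p.1 p.2)
      (continuousOn_driftKernelDt (E := E) ε A) hσ x)
  have hiT : Integrable fun z => h z * driftKernelDt ε A σ (x - z) :=
    hcT.integrable_of_hasCompactSupport (hasCompactSupport_mul_lambda hhs)
  have hiL : Integrable fun z => h z * (Δ (driftKernel (E := E) ε A σ)) (x - z) :=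
    integrable_mul_laplacian_driftKernel hh hhs hσ x
  -- `A‖∇Ψ‖ ≤ ∫ h · A‖∇k‖ ≤ ∫ h · ε(∂_σ k − Δk)`
  have h1 : A * ‖∫ z, h z • fderiv ℝ (driftKernel (E := E) ε A σ) (x - z)‖ ≤
      ∫ z, h z * (A * ‖fderiv ℝ (driftKernel (E := E) ε A σ) (x - z)‖) := by
    calc A * ‖∫ z, h z • fderiv ℝ (driftKernel (E := E) ε A σ) (x - z)‖
        ≤ A * ∫ z, ‖h z • fderiv ℝ (driftKernel (E := E) ε A σ) (x - z)‖ :=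
          mul_le_mul_of_nonneg_left (norm_integral_le_integral_norm _) hA
      _ = ∫ z, h z * (A * ‖fderiv ℝ (driftKernel (E := E) ε A σ) (x - z)‖) := by
          rw [← integral_const_mul]
          refine integral_congr_ae (Eventually.of_forall fun z => ?_)
          simp only [norm_smul, Real.norm_eq_abs, abs_of_nonneg (h0 z)]
          ring
  have h2 : ∫ z, h z * (A * ‖fderiv ℝ (driftKernel (E := E) ε A σ) (x - z)‖) ≤
      ∫ z, h z * (ε * (driftKernelDt ε A σ (x - z) -
        (Δ (driftKernel (E := E) ε A σ)) (x - z))) := by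
    refine integral_mono_of_nonneg (Eventually.of_forall fun z => ?_) ?_
      (Eventually.of_forall fun z => ?_)
    · exact mul_nonneg (h0 z) (mul_nonneg hA (norm_nonneg _))
    · have : (fun z => h z * (ε * (driftKernelDt ε A σ (x - z) -
          (Δ (driftKernel (E := E) ε A σ)) (x - z)))) =
          fun z => ε * (h z * driftKernelDt ε A σ (x - z)) -
            ε * (h z * (Δ (driftKernel (E := E) ε A σ)) (x - z)) := by
        funext z; ring
      rw [this]
      exact (hiT.const_mul ε).sub (hiL.const_mul ε)
    · exact mul_le_mul_of_nonneg_left (driftKernel_ineq hε hA hσ (x - z)) (h0 z)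
  have h3 : ∫ z, h z * (ε * (driftKernelDt ε A σ (x - z) -
      (Δ (driftKernel (E := E) ε A σ)) (x - z))) =
      ε * ((∫ z, h z * driftKernelDt ε A σ (x - z)) -
        ∫ z, h z * (Δ (driftKernel (E := E) ε A σ)) (x - z)) := by
    rw [← integral_sub hiT hiL, ← integral_const_mul]
    refine integral_congr_ae (Eventually.of_forall fun z => ?_)
    ring
  linarith

/-! #### Order properties -/

omit hh hhs in
/-- The barrier of a nonnegative weight is nonnegative (`σ > 0`). [folklore] -/
theorem driftKernelBarrier_nonneg (h0 : ∀ z, 0 ≤ h z) {σ : ℝ} (hσ : 0 < σ) (x : E) :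
    0 ≤ driftKernelBarrier ε A h σ x :=
  integral_nonneg fun z => mul_nonneg (h0 z) (driftKernel_pos ε A hσ _).le

/-- The integrand of the barrier is integrable (`σ > 0`). [folklore] -/
theorem integrable_driftKernelBarrier_integrand {σ : ℝ} (hσ : 0 < σ) (x : E) :
    Integrable fun z => h z * driftKernel ε A σ (x - z) := by
  refine Continuous.integrable_of_hasCompactSupport ?_ (hasCompactSupport_mul_lambda hhs)
  exact hh.mul ((contDiff_driftKernel (N := 0) ε A hσ).continuous.comp (by fun_prop))

/-- Upper bound of the barrier from a pointwise bound of its integrand. [folklore] -/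
theorem driftKernelBarrier_le_integral {σ : ℝ} (hσ : 0 < σ) (x : E) {g : E → ℝ}
    (hg : Integrable g) (hle : ∀ z, h z * driftKernel ε A σ (x - z) ≤ g z) :
    driftKernelBarrier ε A h σ x ≤ ∫ z, g z :=
  integral_mono (integrable_driftKernelBarrier_integrand hh hhs hσ x) hg hle

/-- Lower bound of the barrier from a pointwise bound of its integrand. [folklore] -/
theorem integral_le_driftKernelBarrier {σ : ℝ} (hσ : 0 < σ) (x : E) {g : E → ℝ}
    (hg : Integrable g) (hle : ∀ z, g z ≤ h z * driftKernel ε A σ (x - z)) :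
    ∫ z, g z ≤ driftKernelBarrier ε A h σ x :=
  integral_mono hg (integrable_driftKernelBarrier_integrand hh hhs hσ x) hle

end Regularity

end Literature.Analysis.FluidPDE

end
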